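import Summits.HubbardSuperconductivity.HubbardSuperconductivity.Theorems.DeformationLadderApproximatingHamiltonianGCSourcedBoxes
import Literature.MathematicalPhysics.QuantumLattice.HubbardKleinBottleFlux

/-!
# Route `DeformationLadder`, item `ApproximatingHamiltonianGC` (stmt-HubbardSuperconductivity-1895):
# pair-sourced Hubbard RECTANGLES — row cuts, transposition, stacking

Support file (`--supports stmt-HubbardSuperconductivity-1895`), continuing `…SourcedBoxes.lean`. For the
free-boundary rectangles `Lex (Fin m × Fin n)` with the nearest-neighbour graph and the `d`-wave pair weight
`W_h(p,q) = h·d(coord q − coord p)/√2` pulled back from `ℤ²` (written out in full — no definitions):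

* ROW CUT `E₀(m₁+m₂, n) ≤ E₀(m₁, n) + E₀(m₂, n) + (4|t|+8|h|)n` (`dlsb_rect_rowCut_le`, from the cut
  estimate `dlsc_groundEnergy_le_add_of_cut`: adjacency and weight restrict exactly to the two row blocks —
  the weight only sees coordinate differences — and the seam carries `n` cross bonds each way);
* TRANSPOSITION `E₀(n, m; h) = E₀(m, n; −h)` (`dlsb_rect_transpose`: `(i,j) ↦ (j,i)` is a graph
  isomorphism and `d(e₁,e₀) = −d(e₀,e₁)`);
* STACKING `E₀(kM, n) ≤ k E₀(M, n) + (4|t|+8|h|)nk` (`dlsb_rect_stack_le`, induction; `k = 0` is the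
  vacuum bound on the empty rectangle).

Ruelle, *Statistical Mechanics: Rigorous Results* (1969) §2.2. No definitions are introduced.
-/

set_option linter.dupNamespace false

noncomputable section

namespace Summit.HubbardSuperconductivity.HubbardSuperconductivity.Theorems

open Matrix Finset Literature.MathematicalPhysics.QuantumLattice
open Literature.MathematicalPhysics.QuantumLattice.ThermodynamicLimit
open Literature.Barriers.HubbardSuperconductivity (bondPair bondPair_conjTranspose norm_bondPair_le_two)
open scoped ComplexOrder Matrix.Norms.L2Operator

open Literature.Probability.LatticeModels

/-! ### Rectangles `Lex (Fin m × Fin n)` with the `d`-wave pair weight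

The `m × n` rectangle carries the nearest-neighbour graph pulled back from `ℤ²` along the
coordinate map `p ↦ ![p.1, p.2]` (as in `WcbcsBoxTiling`) and the pair weight
`W_h(p,q) = h · d(coord q − coord p)/√2`; both written out in full (no definitions). -/

section Rectangles

/-- **Row cut for pair-sourced rectangles**: `E₀(m₁+m₂, n; h) ≤ E₀(m₁, n; h) + E₀(m₂, n; h) +
(4|t| + 8|h|)n` — the `(m₁+m₂) × n` rectangle is the ordered disjoint union of its first `m₁` and
last `m₂` rows, adjacency and weight restrict exactly (the weight only sees coordinate
DIFFERENCES), and the ordered cross pairs that are adjacent or weighted are the `n` vertical seam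
bonds in each orientation. [folklore] -/
theorem dlsb_rect_rowCut_le {m₁ m₂ m : ℕ} (hm : m₁ + m₂ = m) (n : ℕ) (t U μ h : ℝ) :
    (hamiltonianWith ((zdGraph 2).comap
        (fun p : Lex (Fin m × Fin n) => ![((ofLex p).1 : ℤ), ((ofLex p).2 : ℤ)])) t U μ -
      ∑ p : Lex (Fin m × Fin n), ∑ q : Lex (Fin m × Fin n),
        ((h * (dWaveFormFactor (![((ofLex q).1 : ℤ), ((ofLex q).2 : ℤ)] -
          ![((ofLex p).1 : ℤ), ((ofLex p).2 : ℤ)]) / Real.sqrt 2) : ℝ) : ℂ) •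
          (bondPair p q + (bondPair p q)ᴴ)).groundEnergy ≤
      (hamiltonianWith ((zdGraph 2).comap
        (fun p : Lex (Fin m₁ × Fin n) => ![((ofLex p).1 : ℤ), ((ofLex p).2 : ℤ)])) t U μ -
      ∑ p : Lex (Fin m₁ × Fin n), ∑ q : Lex (Fin m₁ × Fin n),
        ((h * (dWaveFormFactor (![((ofLex q).1 : ℤ), ((ofLex q).2 : ℤ)] -
          ![((ofLex p).1 : ℤ), ((ofLex p).2 : ℤ)]) / Real.sqrt 2) : ℝ) : ℂ) •
          (bondPair p q + (bondPair p q)ᴴ)).groundEnergy +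
      (hamiltonianWith ((zdGraph 2).comap
        (fun p : Lex (Fin m₂ × Fin n) => ![((ofLex p).1 : ℤ), ((ofLex p).2 : ℤ)])) t U μ -
      ∑ p : Lex (Fin m₂ × Fin n), ∑ q : Lex (Fin m₂ × Fin n),
        ((h * (dWaveFormFactor (![((ofLex q).1 : ℤ), ((ofLex q).2 : ℤ)] -
          ![((ofLex p).1 : ℤ), ((ofLex p).2 : ℤ)]) / Real.sqrt 2) : ℝ) : ℂ) •
          (bondPair p q + (bondPair p q)ᴴ)).groundEnergy +
      (4 * |t| + 8 * |h|) * n := by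
  subst hm
  -- the two row blocks
  set e₁ : Lex (Fin m₁ × Fin n) → Lex (Fin (m₁ + m₂) × Fin n) :=
    fun p => toLex (Fin.castAdd m₂ (ofLex p).1, (ofLex p).2) with he₁def
  set e₂ : Lex (Fin m₂ × Fin n) → Lex (Fin (m₁ + m₂) × Fin n) :=
    fun q => toLex (Fin.natAdd m₁ (ofLex q).1, (ofLex q).2) with he₂def
  have he₁ : StrictMono e₁ := by
    intro p p' hp
    rw [Prod.Lex.lt_iff] at hp ⊢
    simp only [he₁def, ofLex_toLex, Fin.lt_def, Fin.ext_iff, Fin.val_castAdd] at hp ⊢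
    exact hp
  have he₂ : StrictMono e₂ := by
    intro q q' hq
    rw [Prod.Lex.lt_iff] at hq ⊢
    simp only [he₂def, ofLex_toLex, Fin.lt_def, Fin.ext_iff, Fin.val_natAdd] at hq ⊢
    omega
  have h12 : ∀ p q, e₁ p < e₂ q := by
    intro p q
    rw [Prod.Lex.lt_iff]
    simp only [he₁def, he₂def, ofLex_toLex, Fin.lt_def, Fin.val_castAdd, Fin.val_natAdd]
    have := ((ofLex p).1).isLt
    omega
  have hcov : ∀ z, (∃ p, e₁ p = z) ∨ ∃ q, e₂ q = z := by
    intro z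
    obtain ⟨i | i, hi⟩ := finSumFinEquiv.surjective (ofLex z).1
    · refine Or.inl ⟨toLex (i, (ofLex z).2), ?_⟩
      rw [finSumFinEquiv_apply_left] at hi
      simp only [he₁def, ofLex_toLex, hi]
      rfl
    · refine Or.inr ⟨toLex (i, (ofLex z).2), ?_⟩
      rw [finSumFinEquiv_apply_right] at hi
      simp only [he₂def, ofLex_toLex, hi]
      rfl
  -- coordinates of the embedded sites
  have hc₁ : ∀ p : Lex (Fin m₁ × Fin n),
      (![((ofLex (e₁ p)).1 : ℤ), ((ofLex (e₁ p)).2 : ℤ)] : Site 2) =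
        ![((ofLex p).1 : ℤ), ((ofLex p).2 : ℤ)] := by
    intro p
    simp only [he₁def, ofLex_toLex, Fin.val_castAdd]
  have hc₂ : ∀ q : Lex (Fin m₂ × Fin n),
      (![((ofLex (e₂ q)).1 : ℤ), ((ofLex (e₂ q)).2 : ℤ)] : Site 2) =
        ![((ofLex q).1 : ℤ), ((ofLex q).2 : ℤ)] + ![(m₁ : ℤ), 0] := by
    intro q
    simp only [he₂def, ofLex_toLex, Fin.val_natAdd, Nat.cast_add]
    ext i
    fin_cases i <;> simp [add_comm]
  have hG₁ : ∀ p p', ((zdGraph 2).comap (fun p : Lex (Fin (m₁ + m₂) × Fin n) =>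
      ![((ofLex p).1 : ℤ), ((ofLex p).2 : ℤ)])).Adj (e₁ p) (e₁ p') ↔
      ((zdGraph 2).comap (fun p : Lex (Fin m₁ × Fin n) =>
        ![((ofLex p).1 : ℤ), ((ofLex p).2 : ℤ)])).Adj p p' := by
    intro p p'
    simp only [SimpleGraph.comap_adj, hc₁]
  have hG₂ : ∀ q q', ((zdGraph 2).comap (fun p : Lex (Fin (m₁ + m₂) × Fin n) =>
      ![((ofLex p).1 : ℤ), ((ofLex p).2 : ℤ)])).Adj (e₂ q) (e₂ q') ↔
      ((zdGraph 2).comap (fun p : Lex (Fin m₂ × Fin n) =>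
        ![((ofLex p).1 : ℤ), ((ofLex p).2 : ℤ)])).Adj q q' := by
    -- adjacency in `ℤ²` is translation invariant
    have hadd : ∀ a b v : Site 2, (zdGraph 2).Adj (a + v) (b + v) ↔ (zdGraph 2).Adj a b := by
      intro a b v
      rw [zdGraph_adj_iff, zdGraph_adj_iff]
      refine exists_congr fun i => ?_
      rw [add_right_comm a v, add_right_comm b v, add_left_inj, add_left_inj]
    intro q q'
    simp only [SimpleGraph.comap_adj, hc₂, hadd]
  -- the seam: adjacent cross pairs sit in the last row of block 1 / first row of block 2
  have hseam : ∀ (p : Lex (Fin m₁ × Fin n)) (q : Lex (Fin m₂ × Fin n)),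
      ((zdGraph 2).comap (fun p : Lex (Fin (m₁ + m₂) × Fin n) =>
        ![((ofLex p).1 : ℤ), ((ofLex p).2 : ℤ)])).Adj (e₁ p) (e₂ q) →
      ((ofLex p).1 : ℕ) + 1 = m₁ ∧ ((ofLex q).1 : ℕ) = 0 ∧ ((ofLex p).2 : ℕ) = (ofLex q).2 := by
    intro p q hadj
    rw [WcbcsBoxTiling.rect_adj_iff] at hadj
    simp only [he₁def, he₂def, ofLex_toLex, Fin.val_castAdd, Fin.val_natAdd] at hadj
    have := ((ofLex p).1).isLt
    omega
  have hcount : ∀ (P : Lex (Fin m₁ × Fin n) × Lex (Fin m₂ × Fin n) → Prop) [DecidablePred P],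
      (∀ pq, P pq → ((zdGraph 2).comap (fun p : Lex (Fin (m₁ + m₂) × Fin n) =>
        ![((ofLex p).1 : ℤ), ((ofLex p).2 : ℤ)])).Adj (e₁ pq.1) (e₂ pq.2)) →
      #{pq | P pq} ≤ n := by
    intro P _ hP
    calc #{pq | P pq} ≤ (Finset.univ : Finset (Fin n)).card :=
          Finset.card_le_card_of_injOn (fun pq => (ofLex pq.2).2) (fun _ _ => Finset.mem_univ _) ?_
      _ = n := by rw [Finset.card_univ, Fintype.card_fin]
    intro pq hpq pq' hpq' heq
    rw [Finset.mem_coe, Finset.mem_filter] at hpq hpq'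
    obtain ⟨h1, h2, h3⟩ := hseam _ _ (hP _ hpq.2)
    obtain ⟨h1', h2', h3'⟩ := hseam _ _ (hP _ hpq'.2)
    have hc : ((ofLex pq.2).2 : ℕ) = (ofLex pq'.2).2 := congrArg Fin.val heq
    exact Prod.ext (WcbcsBoxTiling.rect_ext (by omega) (by omega))
      (WcbcsBoxTiling.rect_ext (by omega) hc)
  have hcount' : ∀ (P : Lex (Fin m₂ × Fin n) × Lex (Fin m₁ × Fin n) → Prop) [DecidablePred P],
      (∀ qp, P qp → ((zdGraph 2).comap (fun p : Lex (Fin (m₁ + m₂) × Fin n) =>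
        ![((ofLex p).1 : ℤ), ((ofLex p).2 : ℤ)])).Adj (e₂ qp.1) (e₁ qp.2)) →
      #{qp | P qp} ≤ n := by
    intro P _ hP
    calc #{qp | P qp} ≤ (Finset.univ : Finset (Fin n)).card :=
          Finset.card_le_card_of_injOn (fun qp => (ofLex qp.1).2) (fun _ _ => Finset.mem_univ _) ?_
      _ = n := by rw [Finset.card_univ, Fintype.card_fin]
    intro qp hqp qp' hqp' heq
    rw [Finset.mem_coe, Finset.mem_filter] at hqp hqp'
    obtain ⟨h1, h2, h3⟩ := hseam _ _ ((hP _ hqp.2).symm)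
    obtain ⟨h1', h2', h3'⟩ := hseam _ _ ((hP _ hqp'.2).symm)
    have hc : ((ofLex qp.1).2 : ℕ) = (ofLex qp'.1).2 := congrArg Fin.val heq
    exact Prod.ext (WcbcsBoxTiling.rect_ext (by omega) hc)
      (WcbcsBoxTiling.rect_ext (by omega) (by omega))
  -- the cut estimate
  refine dlsc_groundEnergy_le_add_of_cut
    ((zdGraph 2).comap (fun p : Lex (Fin m₁ × Fin n) => ![((ofLex p).1 : ℤ), ((ofLex p).2 : ℤ)]))
    ((zdGraph 2).comap (fun p : Lex (Fin m₂ × Fin n) => ![((ofLex p).1 : ℤ), ((ofLex p).2 : ℤ)]))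
    ((zdGraph 2).comap (fun p : Lex (Fin (m₁ + m₂) × Fin n) => ![((ofLex p).1 : ℤ), ((ofLex p).2 : ℤ)]))
    he₁ he₂ h12 hcov hG₁ hG₂ _
    (fun p q : Lex (Fin m₁ × Fin n) => h * (dWaveFormFactor (![((ofLex q).1 : ℤ), ((ofLex q).2 : ℤ)] -
      ![((ofLex p).1 : ℤ), ((ofLex p).2 : ℤ)]) / Real.sqrt 2))
    (fun p q : Lex (Fin m₂ × Fin n) => h * (dWaveFormFactor (![((ofLex q).1 : ℤ), ((ofLex q).2 : ℤ)] -
      ![((ofLex p).1 : ℤ), ((ofLex p).2 : ℤ)]) / Real.sqrt 2))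
    (fun p p' => by simp only [hc₁]) (fun q q' => by simp only [hc₂, add_sub_add_right_eq_sub])
    (abs_nonneg h)
    (fun p q => dlsb_abs_coordWeight_le
      (fun p : Lex (Fin (m₁ + m₂) × Fin n) => ![((ofLex p).1 : ℤ), ((ofLex p).2 : ℤ)]) h p q)
    (hcount _ fun pq hpq => hpq) (hcount' _ fun qp hqp => hqp)
    (hcount _ fun pq hpq => dlsb_comap_adj_of_coordWeight_ne_zero _ h _ _ hpq)
    (hcount' _ fun qp hqp => dlsb_comap_adj_of_coordWeight_ne_zero _ h _ _ hqp) t U μ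

/-- **Transposition**: `(i,j) ↦ (j,i)` is a graph isomorphism of the `m × n` onto the `n × m`
rectangle reversing the sign of the `d`-wave weight (`d(e₁,e₀) = −d(e₀,e₁)`), so
`E₀(n, m; h) = E₀(m, n; −h)`. [folklore] -/
theorem dlsb_rect_transpose (m n : ℕ) (t U μ h : ℝ) :
    (hamiltonianWith ((zdGraph 2).comap
        (fun p : Lex (Fin n × Fin m) => ![((ofLex p).1 : ℤ), ((ofLex p).2 : ℤ)])) t U μ -
      ∑ p : Lex (Fin n × Fin m), ∑ q : Lex (Fin n × Fin m),
        ((h * (dWaveFormFactor (![((ofLex q).1 : ℤ), ((ofLex q).2 : ℤ)] -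
          ![((ofLex p).1 : ℤ), ((ofLex p).2 : ℤ)]) / Real.sqrt 2) : ℝ) : ℂ) •
          (bondPair p q + (bondPair p q)ᴴ)).groundEnergy =
      (hamiltonianWith ((zdGraph 2).comap
        (fun p : Lex (Fin m × Fin n) => ![((ofLex p).1 : ℤ), ((ofLex p).2 : ℤ)])) t U μ -
      ∑ p : Lex (Fin m × Fin n), ∑ q : Lex (Fin m × Fin n),
        (((-h) * (dWaveFormFactor (![((ofLex q).1 : ℤ), ((ofLex q).2 : ℤ)] -
          ![((ofLex p).1 : ℤ), ((ofLex p).2 : ℤ)]) / Real.sqrt 2) : ℝ) : ℂ) •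
          (bondPair p q + (bondPair p q)ᴴ)).groundEnergy := by
  refine dlsb_groundEnergy_sourced_eq_of_iso
    ((zdGraph 2).comap (fun p : Lex (Fin m × Fin n) => ![((ofLex p).1 : ℤ), ((ofLex p).2 : ℤ)]))
    ((zdGraph 2).comap (fun p : Lex (Fin n × Fin m) => ![((ofLex p).1 : ℤ), ((ofLex p).2 : ℤ)]))
    (ofLex.trans ((Equiv.prodComm (Fin m) (Fin n)).trans toLex)) (fun x y => ?_) _ _
    (fun p q => ?_) t U μ
  · rw [WcbcsBoxTiling.rect_adj_iff, WcbcsBoxTiling.rect_adj_iff]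
    simp only [Equiv.trans_apply, Equiv.prodComm_apply, ofLex_toLex, Prod.fst_swap, Prod.snd_swap]
    tauto
  · simp only [Equiv.trans_apply, Equiv.prodComm_apply, ofLex_toLex, Prod.fst_swap, Prod.snd_swap]
    have hsw : (![((ofLex q).2 : ℤ), ((ofLex q).1 : ℤ)] - ![((ofLex p).2 : ℤ), ((ofLex p).1 : ℤ)] :
        Site 2) = ![(![((ofLex q).1 : ℤ), ((ofLex q).2 : ℤ)] - ![((ofLex p).1 : ℤ), ((ofLex p).2 : ℤ)] :
          Site 2) 1, (![((ofLex q).1 : ℤ), ((ofLex q).2 : ℤ)] - ![((ofLex p).1 : ℤ), ((ofLex p).2 : ℤ)] :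
          Site 2) 0] := by
      ext i; fin_cases i <;> simp
    rw [hsw, dWaveFormFactor_swap]
    ring

/-- **Stacking**: `E₀(kM, n; h) ≤ k E₀(M, n; h) + (4|t| + 8|h|) n k` (row cuts, induction on `k`;
`k = 0` is the vacuum bound on the empty rectangle). [folklore] -/
theorem dlsb_rect_stack_le (M n k : ℕ) (t U μ h : ℝ) :
    (hamiltonianWith ((zdGraph 2).comap
        (fun p : Lex (Fin (k * M) × Fin n) => ![((ofLex p).1 : ℤ), ((ofLex p).2 : ℤ)])) t U μ -
      ∑ p : Lex (Fin (k * M) × Fin n), ∑ q : Lex (Fin (k * M) × Fin n),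
        ((h * (dWaveFormFactor (![((ofLex q).1 : ℤ), ((ofLex q).2 : ℤ)] -
          ![((ofLex p).1 : ℤ), ((ofLex p).2 : ℤ)]) / Real.sqrt 2) : ℝ) : ℂ) •
          (bondPair p q + (bondPair p q)ᴴ)).groundEnergy ≤
      (k : ℝ) * (hamiltonianWith ((zdGraph 2).comap
        (fun p : Lex (Fin M × Fin n) => ![((ofLex p).1 : ℤ), ((ofLex p).2 : ℤ)])) t U μ -
      ∑ p : Lex (Fin M × Fin n), ∑ q : Lex (Fin M × Fin n),
        ((h * (dWaveFormFactor (![((ofLex q).1 : ℤ), ((ofLex q).2 : ℤ)] -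
          ![((ofLex p).1 : ℤ), ((ofLex p).2 : ℤ)]) / Real.sqrt 2) : ℝ) : ℂ) •
          (bondPair p q + (bondPair p q)ᴴ)).groundEnergy + (4 * |t| + 8 * |h|) * n * k := by
  induction k with
  | zero =>
      have h0 := dlsb_groundEnergy_sourced_nonpos ((zdGraph 2).comap
        (fun p : Lex (Fin (0 * M) × Fin n) => ![((ofLex p).1 : ℤ), ((ofLex p).2 : ℤ)]))
        (fun p q : Lex (Fin (0 * M) × Fin n) => h * (dWaveFormFactor (![((ofLex q).1 : ℤ), ((ofLex q).2 : ℤ)] -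
          ![((ofLex p).1 : ℤ), ((ofLex p).2 : ℤ)]) / Real.sqrt 2)) t U μ
      calc _ ≤ (0 : ℝ) := h0
        _ = _ := by rw [Nat.cast_zero]; ring
  | succ k ih =>
      have hcut := dlsb_rect_rowCut_le (Nat.succ_mul k M).symm n t U μ h
      rw [Nat.cast_succ]
      linarith [hcut, ih]

end Rectangles

end Summit.HubbardSuperconductivity.HubbardSuperconductivity.Theorems

end
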